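import Summits.NavierStokesRegularity.NavierStokesRegularity.Theses.FilamentSkeletonRss
import Summits.NavierStokesRegularity.NavierStokesRegularity.Theorems.FilamentSkeletonRssCoreGluingProfileSuffices
import Summits.NavierStokesRegularity.NavierStokesRegularity.Theorems.CoreGluing.Negative.ThresholdLoadBearing
import Summits.NavierStokesRegularity.NavierStokesRegularity.Theorems.CoreGluing.Negative.ParallelLinesSubcritical
import HarnessLib.Audit

/-!
# Route `FilamentSkeletonRss` · crux `CoreGluing` (stmt-NavierStokesRegularity-15401) — line `birth` (BC3 skeleton)

`CoreGluing := SkeletonEquilibrium → RssProfileExists` (route decl, FIXED).  This file is the birth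
certificate skeleton of the crux (planner, skeleton-register, 2026-08-17): TWO named stubs and the
kernel-checked composition `CoreGluing_of` concluding the crux BY NAME.

## Why this cut (and not the dead line `Sketch`)

The dead line `Lines/Sketch.lean` (leads c0–c3) isolated ONE open stub `stub_rssProfileFromSkeleton :
SkeletonEquilibrium → (rotating Leray profile)`, i.e. the crux proper with its formally idle hypothesis
(tree: `Theorems.coreGluing_iff_rssProfileExists_of_skeletonEquilibrium`, p134409; disprover's design
remark in `Cruxes/CoreGluing/Disproof.lean`: `SkeletonEquilibrium` exports no Γ-uniform bounds on the
slips, no localisation, skeletons only along a sequence, and the conclusion's `α` is untied).  The leads'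
recommendation R2 was a QUANTITATIVE, gluing-consumable skeleton statement paired with a genuine gluing
theorem.  Line `birth` realises R2 INSIDE the fixed signature:

* `stub_cyclicSkeletonFamily` (inviscid, finite-dimensional; size L) — there is a CYCLICALLY SYMMETRIC
  supercritical skeleton family with Γ-UNIFORM SLIP CONTROL: the clauses of `SkeletonEquilibrium`
  verbatim (so the stub refines crux K1 = stmt-15400: `skeletonEquilibrium_of_cyclicSkeletonFamily`
  below), PLUS (a) `C_N` symmetry about `e₃` — a linear isometry `R` pinned on the standard basis to the
  rotation by `2π/N`, `Ξ (finRotate N j) = R ∘ Ξ j`, `w` and `γ` invariant (one orbit of equal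
  circulations: the live K1 line's `C₄` datum at `α = −1`, the 2001 chiral `C₃` triple, c1's elliptic
  `C₄` datum D*), which reduces the `N` zero-accretion (slice-mass) solvability scalars of the cores
  (landed p129880/p130322, card zero-accretion-selection, lead c2's `m = 0` audit) to ONE;
  (b) a Γ-uniform two-sided cone for every slip in arclength units, `μ|τ − τ*| ≤ |w_j(τ)|` and
  `|w_j′(τ)| ≤ Λ` (so the unique stagnation point is uniformly transversal, the slip does not return
  to `0`, and the rescaled slips `t ↦ w_j(√Γ t)/√Γ` are Γ-uniformly Lipschitz — exactly what the
  Fuchsian analysis of the core-area law `w A′ = (3/2 − w′)A + 4` (landed p130113) consumes along the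
  WHOLE filament); (c) waist localisation of the cores, `‖Ξ_j(τ*)‖ ≤ Λ√Γ`.
* `stub_viscousCoreGluing` (THE gluing theorem; size XL; no analogue in print) — such a family
  desingularises: for `Γ` large along the family, Burgers-type cores of similarity area
  `A = 4/(w′(τ*) − 3/2)` transported by the core-area law, a Lyapunov–Schmidt reduction modulo rotation
  about `e₃` inside the `C_N`-symmetric class, and SELECTION of the angular speed (the one remaining
  accretion scalar) produce a smooth nontrivial solution `(U, P)` of Perelman's rotated Leray profile
  system `α'(JU − DU[Jy]) + ½U + ½DU[y] − ΔU + DU[U] + ∇P = 0`, `∇·U = 0`, at SOME `α' ≠ 0` (near, not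
  necessarily equal to, the skeleton's `α` — the α-tying of R2 is deliberately dropped: c2's operator
  audit shows `α` must be selected), with profile Type-I decay `‖U y‖ ≤ C₀/(1+‖y‖)` and bounded `P`.
* LANDED bookkeeping `Theorems.stub_rssProfileExists_of_profile` (p130189 = p129518 ∘ p129205): one such
  profile gives `RssProfileExists`.

`CoreGluing_of : CoreGluing` discards the crux's own hypothesis `SkeletonEquilibrium` — unavoidably: by
`Theorems.CoreGluing.Negative.not_coreGluing_iff` / `coreGluing_iff_rssProfileExists_of_skeletonEquilibrium`
any proof of the crux as typed proves the target outright or refutes K1; the skeleton re-derives the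
stronger, consumable skeleton statement as stub 1 instead (the honest form of "K1 feeds K2").
`birth_rssProfileExists_of_stubs` is the same composition with the two stub signatures as explicit
hypotheses.

## Disproof used (Cruxes/CoreGluing/Disproof.lean @ cycle 1; Theorems/CoreGluing/Negative/*)
* `coreGluingAt_iff_rssProfileExists` / `skeletonEquilibrium_holds_below_drift` (any proof must use the
  supercritical threshold): honoured — stub 1 keeps `3/2 + δ ≤ w_j′(τ*)` verbatim (and implies
  `SkeletonEquilibrium`), stub 2 consumes it through the core area `A = 4/(w′ − 3/2) > 0`.
* `parallel_lines_not_supercritical` (axis-parallel cages are never supercritical): consistent — stub 1's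
  witnesses must be genuinely skew configurations; the `C_N` symmetry clause does not force parallelism.
* No landed Negative lemma refutes an instance of either stub (both imported below and co-elaborated).

## What stub 1 still does NOT export (recorded for the stub-2 lead; first re-cut candidates)
non-degeneracy of the relative equilibrium modulo rotation about `e₃` (invertibility of the linearised
tangency map in a weighted space along the spiral ends) and transverse confinement data at the cores.
On the latter: by the stretching identity (landed `stub_stretchingIdentity`) and `div = 0` of the frame
field minus `3/2`, the transverse symmetric block of the frame-field gradient at `Ξ_j(τ*)` has trace
`3/2 − w_j′(τ*) ≤ −δ < 0` AUTOMATICALLY under (SC); Hurwitz-ness of the passive transverse linearisation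
(c2's criterion `det = μ₁μ₂ + α²⟨Ξ′,e₃⟩² > 0`) is a property the stub-2 prover must check on the
family handed over or request as a re-cut of stub 1.
-/

set_option linter.dupNamespace false
set_option linter.unusedVariables false

noncomputable section

namespace Summit.NavierStokesRegularity.NavierStokesRegularity.Cruxes.CoreGluing.Birth

open Summit.NavierStokesRegularity.NavierStokesRegularity.Theses.FilamentSkeletonRss
open MeasureTheory

/-- **Stub 1 (`stub_cyclicSkeletonFamily`, size L) — a cyclically symmetric supercritical skeleton family
with Γ-uniform slip control.**  There are `N ≥ 1` filaments of equal nonzero circulation ratio, an angular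
speed `α ≠ 0`, margins `δ, ρ, μ > 0`, constants `K, Λ` and a linear isometry `R` of `ℝ³` pinned on the
standard basis to the rotation by `2π/N` about `e₃`, such that at ARBITRARILY LARGE circulation `Γ` there
are `C²` unit-speed injective proper curves `Ξ_j`, pairwise `ρ√Γ`-separated, of curvature `≤ K/√Γ`, with
Rosenhead-kernel integrability, in EXACT relative equilibrium of the regularised Biot–Savart law in the
rotating Leray frame with slips `w_j` (the clauses of `SkeletonEquilibrium`, verbatim), which moreover are
`C_N`-symmetric (`Ξ (finRotate N j) = R ∘ Ξ j`, `w (finRotate N j) = w j`), have Γ-uniformly Lipschitz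
slips `|w_j′| ≤ Λ`, and on each filament a unique stagnation point `τ*` with supercritical stretching
`w_j′(τ*) ≥ 3/2 + δ`, waist localisation `‖Ξ_j(τ*)‖ ≤ Λ√Γ` and the transversality cone
`μ|τ − τ*| ≤ |w_j(τ)|`.  Why plausibly true: the live K1 line (Cruxes/SkeletonEquilibrium/Lines/Sketch.lean
v9: `C₄` orbit of skew lines, `α = −1`, slips `ε`-close in `C¹` to an explicit rational model with a
kernel-certified unique zero of slope `≥ 2`) delivers every clause on `|t| ≤ 10` in waist units; the cone
and the Lipschitz bound beyond the window are the drift asymptotics `w ∼ τ/2` of the log-spiral ends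
(landed `stub_outerSlopeHalf`).  Leans on: GutierrezVega2004 Thm 1, BanicaVega arXiv:0802.1996 §1,
HormozBrenner doi:10.1017/jfm.2012.270 §3, Aref doi:10.1063/1.3425649; tree p134392 p136450 p132445. -/
theorem stub_cyclicSkeletonFamily :
    ∃ (N : ℕ) (γ : Fin N → ℝ) (α δ ρ K Λ μ : ℝ) (R : EuclideanSpace ℝ (Fin 3) ≃ₗᵢ[ℝ] EuclideanSpace ℝ (Fin 3)), 0 < N ∧ α ≠ 0 ∧ 0 < δ ∧ 0 < ρ ∧ 0 < μ ∧ (∀ j, γ j ≠ 0) ∧ (∀ j, γ (finRotate N j) = γ j) ∧ (R (EuclideanSpace.single 0 1) = Real.cos (2 * Real.pi / (N : ℝ)) • EuclideanSpace.single 0 1 + Real.sin (2 * Real.pi / (N : ℝ)) • EuclideanSpace.single 1 1 ∧ R (EuclideanSpace.single 1 1) = -(Real.sin (2 * Real.pi / (N : ℝ)) • EuclideanSpace.single 0 1) + Real.cos (2 * Real.pi / (N : ℝ)) • EuclideanSpace.single 1 1 ∧ R (EuclideanSpace.single 2 1) = EuclideanSpace.single 2 1) ∧ ∀ Γ₀ :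 ℝ, ∃ Γ : ℝ, Γ₀ ≤ Γ ∧ 0 < Γ ∧ ∃ (Ξ : Fin N → ℝ → EuclideanSpace ℝ (Fin 3)) (w : Fin N → ℝ → ℝ), (∀ j, ContDiff ℝ 2 (Ξ j) ∧ Function.Injective (Ξ j) ∧ Differentiable ℝ (w j) ∧ (∀ τ, ‖deriv (Ξ j) τ‖ = 1) ∧ (∀ τ, ‖iteratedDeriv 2 (Ξ j) τ‖ * Real.sqrt Γ ≤ K) ∧ Filter.Tendsto (fun τ => ‖Ξ j τ‖) Filter.atTop Filter.atTop ∧ Filter.Tendsto (fun τ => ‖Ξ j τ‖) Filter.atBot Filter.atTop) ∧ (∀ j k, j ≠ k → ∀ τ σ, ρ * Real.sqrt Γ ≤ ‖Ξ j τ - Ξ k σ‖) ∧ (∀ j (x : EuclideanSpace ℝ (Fin 3)), MeasureTheory.Integrable (fun σ : ℝ => ((‖x - Ξ j σ‖ ^ 2 + 1) ^ (3 / 2 : ℝ))⁻¹ • Literature.Analysis.FluidPDE.cross (deriv (Ξ j) σ) (x - Ξ j σ))) ∧ (∀ j τ, (∑ k : Fin N, (Γ * γ k / (4 * Real.pi))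 • ∫ σ : ℝ, ((‖Ξ j τ - Ξ k σ‖ ^ 2 + 1) ^ (3 / 2 : ℝ))⁻¹ • Literature.Analysis.FluidPDE.cross (deriv (Ξ k) σ) (Ξ j τ - Ξ k σ)) + (1 / 2 : ℝ) • Ξ j τ - α • Literature.Analysis.FluidPDE.cross (EuclideanSpace.single (2 : Fin 3) (1 : ℝ)) (Ξ j τ) = w j τ • deriv (Ξ j) τ) ∧ (∀ j τ, Ξ (finRotate N j) τ = R (Ξ j τ) ∧ w (finRotate N j) τ = w j τ) ∧ (∀ j τ, |deriv (w j) τ| ≤ Λ) ∧ (∀ j, ∃ τs : ℝ, w j τs = 0 ∧ (∀ τ, w j τ = 0 → τ = τs) ∧ 3 / 2 + δ ≤ deriv (w j) τs ∧ ‖Ξ j τs‖ ≤ Λ * Real.sqrt Γ ∧ (∀ τ, μ * |τ - τs| ≤ |w j τ|)) := by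
  sorry

/-- **Stub 2 (`stub_viscousCoreGluing`, size XL — the gluing theorem proper).**  A cyclically symmetric
supercritical skeleton family with Γ-uniform slip control (exactly the statement of
`stub_cyclicSkeletonFamily`) desingularises into a smooth nontrivial solution `(U, P)` of the rotated
Leray profile system (Pineau–Vicol 2026, (1.8)) at SOME angular speed `α' ≠ 0`, with profile Type-I decay
`‖U y‖ ≤ C₀/(1 + ‖y‖)` and bounded pressure.  Intended proof: dress each filament, for `Γ` large along the
family, with a strained Gaussian (Burgers-type) core of similarity area `A_j(τ)` solving the core-area law
`w_j A_j′ = (3/2 − w_j′)A_j + 4` (unique bounded positive solution by the cone and (SC): landed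
`stub_coreAreaFuchsianRigidity` p130113, `stub_accretionBudget*` p129880/p130322), residual `O(Γ^{-1/2})`
relative to the core terms; Lyapunov–Schmidt modulo rotation about `e₃` (landed
`stub_profileRotationCovariance` p131903) inside the `C_N`-symmetric class; Type-I envelope by outward
transport (landed `stub_outwardTransportEnvelope` p131978); the single remaining zero-accretion scalar is
killed by selecting `α'` near the skeleton's `α`.  Why it might fail: neutral Kelvin bending modes of the
cores at strain/rotation ratio `O(1)` do not scale away with `Γ` (route kill criterion (ii); Disproof.lean);
3-D Burgers stability is known only in restricted regimes (Gallay–Wayne arXiv:math/0503353, Gallay–Maekawa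
arXiv:1002.2489, Maekawa–Miura–Prange arXiv:1807.10341; gluing templates Gallay arXiv:0908.2518,
Albritton–Brué–Colombo arXiv:2112.03116); `C₀ ≲ Γ^{3/2}` must keep `α'` inside Pineau–Vicol's window
(arXiv:2607.09619, Thm 1.4).  No analogue in print. -/
theorem stub_viscousCoreGluing :
    (∃ (N : ℕ) (γ : Fin N → ℝ) (α δ ρ K Λ μ : ℝ) (R : EuclideanSpace ℝ (Fin 3) ≃ₗᵢ[ℝ] EuclideanSpace ℝ (Fin 3)), 0 < N ∧ α ≠ 0 ∧ 0 < δ ∧ 0 < ρ ∧ 0 < μ ∧ (∀ j, γ j ≠ 0) ∧ (∀ j, γ (finRotate N j) = γ j) ∧ (R (EuclideanSpace.single 0 1) = Real.cos (2 * Real.pi / (N : ℝ)) • EuclideanSpace.single 0 1 + Real.sin (2 * Real.pi / (N : ℝ)) • EuclideanSpace.single 1 1 ∧ R (EuclideanSpace.single 1 1) = -(Real.sin (2 * Real.pi / (N : ℝ)) • EuclideanSpace.single 0 1) + Real.cos (2 * Real.pi / (N : ℝ)) • EuclideanSpace.single 1 1 ∧ R (EuclideanSpace.single 2 1) = EuclideanSpace.single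 2 1) ∧ ∀ Γ₀ : ℝ, ∃ Γ : ℝ, Γ₀ ≤ Γ ∧ 0 < Γ ∧ ∃ (Ξ : Fin N → ℝ → EuclideanSpace ℝ (Fin 3)) (w : Fin N → ℝ → ℝ), (∀ j, ContDiff ℝ 2 (Ξ j) ∧ Function.Injective (Ξ j) ∧ Differentiable ℝ (w j) ∧ (∀ τ, ‖deriv (Ξ j) τ‖ = 1) ∧ (∀ τ, ‖iteratedDeriv 2 (Ξ j) τ‖ * Real.sqrt Γ ≤ K) ∧ Filter.Tendsto (fun τ => ‖Ξ j τ‖) Filter.atTop Filter.atTop ∧ Filter.Tendsto (fun τ => ‖Ξ j τ‖) Filter.atBot Filter.atTop) ∧ (∀ j k, j ≠ k → ∀ τ σ, ρ * Real.sqrt Γ ≤ ‖Ξ j τ - Ξ k σ‖) ∧ (∀ j (x : EuclideanSpace ℝ (Fin 3)), MeasureTheory.Integrable (fun σ : ℝ => ((‖x - Ξ j σ‖ ^ 2 + 1) ^ (3 / 2 : ℝ))⁻¹ • Literature.Analysis.FluidPDE.cross (deriv (Ξ j) σ) (x - Ξ j σ))) ∧ (∀ j τ, (∑ k : Fin N,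 (Γ * γ k / (4 * Real.pi)) • ∫ σ : ℝ, ((‖Ξ j τ - Ξ k σ‖ ^ 2 + 1) ^ (3 / 2 : ℝ))⁻¹ • Literature.Analysis.FluidPDE.cross (deriv (Ξ k) σ) (Ξ j τ - Ξ k σ)) + (1 / 2 : ℝ) • Ξ j τ - α • Literature.Analysis.FluidPDE.cross (EuclideanSpace.single (2 : Fin 3) (1 : ℝ)) (Ξ j τ) = w j τ • deriv (Ξ j) τ) ∧ (∀ j τ, Ξ (finRotate N j) τ = R (Ξ j τ) ∧ w (finRotate N j) τ = w j τ) ∧ (∀ j τ, |deriv (w j) τ| ≤ Λ) ∧ (∀ j, ∃ τs : ℝ, w j τs = 0 ∧ (∀ τ, w j τ = 0 → τ = τs) ∧ 3 / 2 + δ ≤ deriv (w j) τs ∧ ‖Ξ j τs‖ ≤ Λ * Real.sqrt Γ ∧ (∀ τ, μ * |τ - τs| ≤ |w j τ|))) → ∃ (α C₀ M : ℝ) (U : EuclideanSpace ℝ (Fin 3) → EuclideanSpace ℝ (Fin 3)) (P : EuclideanSpace ℝ (Fin 3) → ℝ), α ≠ 0 ∧ U ≠ 0 ∧ ContDiff ℝ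 (⊤ : ℕ∞) U ∧ ContDiff ℝ (⊤ : ℕ∞) P ∧ Literature.Analysis.FluidPDE.VectorCalculus.IsDivFree U ∧ (∀ y : EuclideanSpace ℝ (Fin 3), α • (Literature.Analysis.FluidPDE.rotGen (U y) - fderiv ℝ U y (Literature.Analysis.FluidPDE.rotGen y)) + (1 / 2 : ℝ) • U y + (1 / 2 : ℝ) • fderiv ℝ U y y - Laplacian.laplacian U y + fderiv ℝ U y (U y) + gradient P y = 0) ∧ (∀ y : EuclideanSpace ℝ (Fin 3), ‖U y‖ ≤ C₀ / (1 + ‖y‖)) ∧ (∀ y : EuclideanSpace ℝ (Fin 3), |P y| ≤ M) := by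
  sorry

/-- **Stub 1 refines the sibling crux K1.**  Forgetting the symmetry, the slip cone, the Lipschitz bound
and the localisation gives `SkeletonEquilibrium` verbatim — so the line honours the disprover's
load-bearing clause (the supercritical threshold `3/2 + δ`, `Negative.skeletonEquilibrium_holds_below_drift`)
and K1's refutation would kill stub 1. [folklore] -/
theorem skeletonEquilibrium_of_cyclicSkeletonFamily
    (h : ∃ (N : ℕ) (γ : Fin N → ℝ) (α δ ρ K Λ μ : ℝ) (R : EuclideanSpace ℝ (Fin 3) ≃ₗᵢ[ℝ] EuclideanSpace ℝ (Fin 3)), 0 < N ∧ α ≠ 0 ∧ 0 < δ ∧ 0 < ρ ∧ 0 < μ ∧ (∀ j, γ j ≠ 0) ∧ (∀ j, γ (finRotate N j) = γ j) ∧ (R (EuclideanSpace.single 0 1) = Real.cos (2 * Real.pi / (N : ℝ)) • EuclideanSpace.single 0 1 + Real.sin (2 * Real.pi / (N : ℝ)) • EuclideanSpace.single 1 1 ∧ R (EuclideanSpace.single 1 1) = -(Real.sin (2 * Real.pi / (N : ℝ)) • EuclideanSpace.single 0 1) + Real.cos (2 * Real.pi / (N : ℝ)) • EuclideanSpace.single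 1 1 ∧ R (EuclideanSpace.single 2 1) = EuclideanSpace.single 2 1) ∧ ∀ Γ₀ : ℝ, ∃ Γ : ℝ, Γ₀ ≤ Γ ∧ 0 < Γ ∧ ∃ (Ξ : Fin N → ℝ → EuclideanSpace ℝ (Fin 3)) (w : Fin N → ℝ → ℝ), (∀ j, ContDiff ℝ 2 (Ξ j) ∧ Function.Injective (Ξ j) ∧ Differentiable ℝ (w j) ∧ (∀ τ, ‖deriv (Ξ j) τ‖ = 1) ∧ (∀ τ, ‖iteratedDeriv 2 (Ξ j) τ‖ * Real.sqrt Γ ≤ K) ∧ Filter.Tendsto (fun τ => ‖Ξ j τ‖) Filter.atTop Filter.atTop ∧ Filter.Tendsto (fun τ => ‖Ξ j τ‖) Filter.atBot Filter.atTop) ∧ (∀ j k, j ≠ k → ∀ τ σ, ρ * Real.sqrt Γ ≤ ‖Ξ j τ - Ξ k σ‖) ∧ (∀ j (x : EuclideanSpace ℝ (Fin 3)), MeasureTheory.Integrable (fun σ : ℝ => ((‖x - Ξ j σ‖ ^ 2 + 1) ^ (3 / 2 : ℝ))⁻¹ • Literature.Analysis.FluidPDE.cross (deriv (Ξ j) σ)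 (x - Ξ j σ))) ∧ (∀ j τ, (∑ k : Fin N, (Γ * γ k / (4 * Real.pi)) • ∫ σ : ℝ, ((‖Ξ j τ - Ξ k σ‖ ^ 2 + 1) ^ (3 / 2 : ℝ))⁻¹ • Literature.Analysis.FluidPDE.cross (deriv (Ξ k) σ) (Ξ j τ - Ξ k σ)) + (1 / 2 : ℝ) • Ξ j τ - α • Literature.Analysis.FluidPDE.cross (EuclideanSpace.single (2 : Fin 3) (1 : ℝ)) (Ξ j τ) = w j τ • deriv (Ξ j) τ) ∧ (∀ j τ, Ξ (finRotate N j) τ = R (Ξ j τ) ∧ w (finRotate N j) τ = w j τ) ∧ (∀ j τ, |deriv (w j) τ| ≤ Λ) ∧ (∀ j, ∃ τs : ℝ, w j τs = 0 ∧ (∀ τ, w j τ = 0 → τ = τs) ∧ 3 / 2 + δ ≤ deriv (w j) τs ∧ ‖Ξ j τs‖ ≤ Λ * Real.sqrt Γ ∧ (∀ τ, μ * |τ - τs| ≤ |w j τ|))) :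
    Summit.NavierStokesRegularity.NavierStokesRegularity.Theses.FilamentSkeletonRss.SkeletonEquilibrium := by
  obtain ⟨N, γ, α, δ, ρ, K, Λ, μ, R, hN, hα, hδ, hρ, hμ, hγ, hγsym, hR, H⟩ := h
  refine ⟨N, γ, α, δ, ρ, K, hN, hα, hδ, hρ, hγ, fun Γ₀ => ?_⟩
  obtain ⟨Γ, h1, h2, Ξ, w, hA, hB, hC, hD, hS, hL, hE⟩ := H Γ₀
  refine ⟨Γ, h1, h2, Ξ, w, hA, hB, hC, hD, fun j => ?_⟩
  obtain ⟨τs, h0, huniq, hsc, -, -⟩ := hE j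
  exact ⟨τs, h0, huniq, hsc⟩

/-- **The composition with explicit stub signatures**: stub 1 and stub 2 give the route TARGET
`RssProfileExists` (through the landed `Theorems.stub_rssProfileExists_of_profile`, p130189). [folklore] -/
theorem birth_rssProfileExists_of_stubs
    (h1 : ∃ (N : ℕ) (γ : Fin N → ℝ) (α δ ρ K Λ μ : ℝ) (R : EuclideanSpace ℝ (Fin 3) ≃ₗᵢ[ℝ] EuclideanSpace ℝ (Fin 3)), 0 < N ∧ α ≠ 0 ∧ 0 < δ ∧ 0 < ρ ∧ 0 < μ ∧ (∀ j, γ j ≠ 0) ∧ (∀ j, γ (finRotate N j) = γ j) ∧ (R (EuclideanSpace.single 0 1) = Real.cos (2 * Real.pi / (N : ℝ)) • EuclideanSpace.single 0 1 + Real.sin (2 * Real.pi / (N : ℝ)) • EuclideanSpace.single 1 1 ∧ R (EuclideanSpace.single 1 1) = -(Real.sin (2 * Real.pi / (N : ℝ)) • EuclideanSpace.single 0 1) + Real.cos (2 * Real.pi / (N : ℝ)) • EuclideanSpace.single 1 1 ∧ R (EuclideanSpace.single 2 1) = EuclideanSpace.single 2 1) ∧ ∀ Γ₀ : ℝ, ∃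 Γ : ℝ, Γ₀ ≤ Γ ∧ 0 < Γ ∧ ∃ (Ξ : Fin N → ℝ → EuclideanSpace ℝ (Fin 3)) (w : Fin N → ℝ → ℝ), (∀ j, ContDiff ℝ 2 (Ξ j) ∧ Function.Injective (Ξ j) ∧ Differentiable ℝ (w j) ∧ (∀ τ, ‖deriv (Ξ j) τ‖ = 1) ∧ (∀ τ, ‖iteratedDeriv 2 (Ξ j) τ‖ * Real.sqrt Γ ≤ K) ∧ Filter.Tendsto (fun τ => ‖Ξ j τ‖) Filter.atTop Filter.atTop ∧ Filter.Tendsto (fun τ => ‖Ξ j τ‖) Filter.atBot Filter.atTop) ∧ (∀ j k, j ≠ k → ∀ τ σ, ρ * Real.sqrt Γ ≤ ‖Ξ j τ - Ξ k σ‖) ∧ (∀ j (x : EuclideanSpace ℝ (Fin 3)), MeasureTheory.Integrable (fun σ : ℝ => ((‖x - Ξ j σ‖ ^ 2 + 1) ^ (3 / 2 : ℝ))⁻¹ • Literature.Analysis.FluidPDE.cross (deriv (Ξ j) σ) (x - Ξ j σ))) ∧ (∀ j τ, (∑ k : Fin N, (Γ * γ k / (4 * Real.pi)) • ∫ σ :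 ℝ, ((‖Ξ j τ - Ξ k σ‖ ^ 2 + 1) ^ (3 / 2 : ℝ))⁻¹ • Literature.Analysis.FluidPDE.cross (deriv (Ξ k) σ) (Ξ j τ - Ξ k σ)) + (1 / 2 : ℝ) • Ξ j τ - α • Literature.Analysis.FluidPDE.cross (EuclideanSpace.single (2 : Fin 3) (1 : ℝ)) (Ξ j τ) = w j τ • deriv (Ξ j) τ) ∧ (∀ j τ, Ξ (finRotate N j) τ = R (Ξ j τ) ∧ w (finRotate N j) τ = w j τ) ∧ (∀ j τ, |deriv (w j) τ| ≤ Λ) ∧ (∀ j, ∃ τs : ℝ, w j τs = 0 ∧ (∀ τ, w j τ = 0 → τ = τs) ∧ 3 / 2 + δ ≤ deriv (w j) τs ∧ ‖Ξ j τs‖ ≤ Λ * Real.sqrt Γ ∧ (∀ τ, μ * |τ - τs| ≤ |w j τ|)))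
    (h2 : (∃ (N : ℕ) (γ : Fin N → ℝ) (α δ ρ K Λ μ : ℝ) (R : EuclideanSpace ℝ (Fin 3) ≃ₗᵢ[ℝ] EuclideanSpace ℝ (Fin 3)), 0 < N ∧ α ≠ 0 ∧ 0 < δ ∧ 0 < ρ ∧ 0 < μ ∧ (∀ j, γ j ≠ 0) ∧ (∀ j, γ (finRotate N j) = γ j) ∧ (R (EuclideanSpace.single 0 1) = Real.cos (2 * Real.pi / (N : ℝ)) • EuclideanSpace.single 0 1 + Real.sin (2 * Real.pi / (N : ℝ)) • EuclideanSpace.single 1 1 ∧ R (EuclideanSpace.single 1 1) = -(Real.sin (2 * Real.pi / (N : ℝ)) • EuclideanSpace.single 0 1) + Real.cos (2 * Real.pi / (N : ℝ)) • EuclideanSpace.single 1 1 ∧ R (EuclideanSpace.single 2 1) = EuclideanSpace.single 2 1) ∧ ∀ Γ₀ : ℝ, ∃ Γ : ℝ, Γ₀ ≤ Γ ∧ 0 < Γ ∧ ∃ (Ξ : Fin N → ℝ → EuclideanSpace ℝ (Fin 3)) (w : Fin N → ℝ → ℝ), (∀ j, ContDiff ℝ 2 (Ξ j) ∧ Function.Injective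 (Ξ j) ∧ Differentiable ℝ (w j) ∧ (∀ τ, ‖deriv (Ξ j) τ‖ = 1) ∧ (∀ τ, ‖iteratedDeriv 2 (Ξ j) τ‖ * Real.sqrt Γ ≤ K) ∧ Filter.Tendsto (fun τ => ‖Ξ j τ‖) Filter.atTop Filter.atTop ∧ Filter.Tendsto (fun τ => ‖Ξ j τ‖) Filter.atBot Filter.atTop) ∧ (∀ j k, j ≠ k → ∀ τ σ, ρ * Real.sqrt Γ ≤ ‖Ξ j τ - Ξ k σ‖) ∧ (∀ j (x : EuclideanSpace ℝ (Fin 3)), MeasureTheory.Integrable (fun σ : ℝ => ((‖x - Ξ j σ‖ ^ 2 + 1) ^ (3 / 2 : ℝ))⁻¹ • Literature.Analysis.FluidPDE.cross (deriv (Ξ j) σ) (x - Ξ j σ))) ∧ (∀ j τ, (∑ k : Fin N, (Γ * γ k / (4 * Real.pi)) • ∫ σ : ℝ, ((‖Ξ j τ - Ξ k σ‖ ^ 2 + 1) ^ (3 / 2 : ℝ))⁻¹ • Literature.Analysis.FluidPDE.cross (deriv (Ξ k) σ) (Ξ j τ - Ξ k σ)) + (1 / 2 : ℝ) • Ξ j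 τ - α • Literature.Analysis.FluidPDE.cross (EuclideanSpace.single (2 : Fin 3) (1 : ℝ)) (Ξ j τ) = w j τ • deriv (Ξ j) τ) ∧ (∀ j τ, Ξ (finRotate N j) τ = R (Ξ j τ) ∧ w (finRotate N j) τ = w j τ) ∧ (∀ j τ, |deriv (w j) τ| ≤ Λ) ∧ (∀ j, ∃ τs : ℝ, w j τs = 0 ∧ (∀ τ, w j τ = 0 → τ = τs) ∧ 3 / 2 + δ ≤ deriv (w j) τs ∧ ‖Ξ j τs‖ ≤ Λ * Real.sqrt Γ ∧ (∀ τ, μ * |τ - τs| ≤ |w j τ|))) → ∃ (α C₀ M : ℝ) (U : EuclideanSpace ℝ (Fin 3) → EuclideanSpace ℝ (Fin 3)) (P : EuclideanSpace ℝ (Fin 3) → ℝ), α ≠ 0 ∧ U ≠ 0 ∧ ContDiff ℝ (⊤ : ℕ∞) U ∧ ContDiff ℝ (⊤ : ℕ∞) P ∧ Literature.Analysis.FluidPDE.VectorCalculus.IsDivFree U ∧ (∀ y : EuclideanSpace ℝ (Fin 3), α • (Literature.Analysis.FluidPDE.rotGen (U y) - fderiv ℝ U y (Literature.Analysis.FluidPDE.rotGen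 y)) + (1 / 2 : ℝ) • U y + (1 / 2 : ℝ) • fderiv ℝ U y y - Laplacian.laplacian U y + fderiv ℝ U y (U y) + gradient P y = 0) ∧ (∀ y : EuclideanSpace ℝ (Fin 3), ‖U y‖ ≤ C₀ / (1 + ‖y‖)) ∧ (∀ y : EuclideanSpace ℝ (Fin 3), |P y| ≤ M)) :
    Summit.NavierStokesRegularity.NavierStokesRegularity.Theses.FilamentSkeletonRss.RssProfileExists :=
  Summit.NavierStokesRegularity.NavierStokesRegularity.Theorems.stub_rssProfileExists_of_profile (h2 h1)

/-- **Skeleton theorem.**  `CoreGluing` BY NAME from the two stubs (the crux's own hypothesis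
`SkeletonEquilibrium` is not consumed — see the module docstring; stub 1 is its consumable refinement). -/
theorem CoreGluing_of : Summit.NavierStokesRegularity.NavierStokesRegularity.Theses.FilamentSkeletonRss.CoreGluing :=
  fun _ => birth_rssProfileExists_of_stubs stub_cyclicSkeletonFamily stub_viscousCoreGluing

end Summit.NavierStokesRegularity.NavierStokesRegularity.Cruxes.CoreGluing.Birth

end
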